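import Summits.Parity.BatemanHorn.Theorems.SoloInformedPolynomialRoughValues

/-!
# The classical upper bound `π_g(N) ≤ (2 C(g) + δ) N / log N` for ONE polynomial of any degree

Solo unit `solo-Parity-informed` (ideation tier, informed mode), session 13; `PLAN.md` §21, CLAIMS C58.

For `g ∈ ℤ[X]` of degree `d ≥ 2` forming a Bateman–Horn system the conjecture predicts
`π_g(N) ~ C(g) N /(d log N)`. From the rough-values bound of `SoloInformedPolynomialRoughValues`:

* `eventually_polyPrimeCount_le` — `π_g(N) ≤ (2 C(g) + δ) N / log N` for every `δ > 0` and all large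
  `N`, i.e. `2d` times the prediction (Halberstam–Richert, *Sieve Methods*, Thm 5.3), for EVERY degree
  (session 12: `d = 2` only). The prime values below the sieving level `N^c` are discarded with the
  fibre bound `#{n : |g(n)| = m} ≤ 2d` (`card_primeValues_le_card_rough_add`).

References: H. Halberstam, H.-E. Richert, *Sieve Methods* (Academic Press 1974) Thm 5.3; P. T. Bateman,
R. A. Horn, Math. Comp. 16 (1962) 363–367 [BatemanHorn1962].
-/

namespace Summit.Parity.BatemanHorn.Theorems

open Finset Filter Asymptotics Polynomial
open scoped Topology
open Literature.NumberTheory.Sieve (polyRootCountMod IsBatemanHornSystem batemanHornConst polyPrimeCount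
  primesProdBelow dvd_primesProdBelow_iff)

/-! ### `π_g(N) ≤ (2 C(g) + δ) N / log N` -/

/-- `A x^c (log x)² ≤ δ x` eventually, for `c < 1`. -/
theorem eventually_mul_rpow_mul_log_sq_le {c : ℝ} (hc : c < 1) {A : ℝ} (hA : 0 ≤ A) {δ : ℝ}
    (hδ : 0 < δ) :
    ∀ᶠ x : ℕ in atTop, A * ((x : ℝ) ^ c * Real.log x ^ 2) ≤ δ * x := by
  have hη0 : 0 < δ / (A + 1) := by positivity
  have hlo := ((isLittleO_log_rpow_rpow_atTop 2 (sub_pos.mpr hc)).comp_tendsto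
    tendsto_natCast_atTop_atTop).bound hη0
  filter_upwards [hlo, eventually_ge_atTop 1] with x hx hx1
  simp only [Function.comp_apply, Real.norm_eq_abs, Real.rpow_two] at hx
  have hx0 : (0 : ℝ) < x := by exact_mod_cast hx1
  rw [abs_of_nonneg (sq_nonneg _), abs_of_nonneg (by positivity)] at hx
  have hsplit : (x : ℝ) ^ c * (x : ℝ) ^ (1 - c) = x := by
    rw [← Real.rpow_add hx0, add_sub_cancel, Real.rpow_one]
  have hA1 : A / (A + 1) ≤ 1 := (div_le_one (by positivity)).mpr (by linarith)
  calc A * ((x : ℝ) ^ c * Real.log x ^ 2)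
      ≤ A * ((x : ℝ) ^ c * (δ / (A + 1) * (x : ℝ) ^ (1 - c))) := by gcongr
    _ = A / (A + 1) * δ * ((x : ℝ) ^ c * (x : ℝ) ^ (1 - c)) := by ring
    _ = A / (A + 1) * δ * x := by rw [hsplit]
    _ ≤ 1 * δ * x := by gcongr
    _ = δ * x := by ring

/-- The prime values below the sieving level: `#{1 ≤ n ≤ N : |g(n)| prime} ≤
#{1 ≤ n ≤ N : (|g(n)|, P(z)) = 1} + 2 deg g · ⌈z⌉` (a prime `|g(n)|` not coprime to `P(z)` is `< z`,
and each value is taken at most `2 deg g` times). -/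
theorem card_primeValues_le_card_rough_add (g : ℤ[X]) (hdeg : 0 < g.natDegree) (N : ℕ) (z : ℝ) :
    #((Icc 1 N).filter fun n : ℕ => Nat.Prime (g.eval (n : ℤ)).natAbs) ≤
      #((Icc 1 N).filter fun n : ℕ => ((g.eval (n : ℤ)).natAbs).Coprime (primesProdBelow z))
        + 2 * g.natDegree * ⌈z⌉₊ := by
  set P := (Icc 1 N).filter fun n : ℕ => Nat.Prime (g.eval (n : ℤ)).natAbs with hP
  set R := (Icc 1 N).filter fun n : ℕ => ((g.eval (n : ℤ)).natAbs).Coprime (primesProdBelow z)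
    with hR
  set S := P.filter fun n : ℕ => ¬ ((g.eval (n : ℤ)).natAbs).Coprime (primesProdBelow z) with hS
  have hsub : P ⊆ R ∪ S := by
    intro n hn
    rw [mem_union]
    by_cases hc : ((g.eval (n : ℤ)).natAbs).Coprime (primesProdBelow z)
    · exact Or.inl (mem_filter.mpr ⟨(mem_filter.mp hn).1, hc⟩)
    · exact Or.inr (mem_filter.mpr ⟨hn, hc⟩)
  have himg : S.image (fun n : ℕ => (g.eval (n : ℤ)).natAbs) ⊆ Nat.primesBelow ⌈z⌉₊ := by
    intro m hm
    obtain ⟨n, hn, rfl⟩ := mem_image.mp hm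
    obtain ⟨hnP, hnc⟩ := mem_filter.mp hn
    have hpr : Nat.Prime (g.eval (n : ℤ)).natAbs := (mem_filter.mp hnP).2
    have hdvd : (g.eval (n : ℤ)).natAbs ∣ primesProdBelow z := by
      by_contra hnd
      exact hnc ((Nat.Prime.coprime_iff_not_dvd hpr).mpr hnd)
    have hltz : (((g.eval (n : ℤ)).natAbs : ℕ) : ℝ) < z := (dvd_primesProdBelow_iff hpr z).mp hdvd
    exact Nat.mem_primesBelow.mpr ⟨Nat.lt_ceil.mpr hltz, hpr⟩
  have hS' : #S ≤ 2 * g.natDegree * ⌈z⌉₊ := by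
    calc #S ≤ 2 * g.natDegree * #(S.image fun n : ℕ => (g.eval (n : ℤ)).natAbs) :=
          card_le_mul_card_image S _ fun m _ => card_filter_natAbs_eval_eq_le g hdeg S m
      _ ≤ 2 * g.natDegree * #(Nat.primesBelow ⌈z⌉₊) := Nat.mul_le_mul_left _ (card_le_card himg)
      _ ≤ 2 * g.natDegree * ⌈z⌉₊ := by
          refine Nat.mul_le_mul_left _ ?_
          unfold Nat.primesBelow
          exact (card_filter_le _ _).trans (card_range _).le
  calc #P ≤ #(R ∪ S) := card_le_card hsub
    _ ≤ #R + #S := card_union_le _ _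
    _ ≤ #R + 2 * g.natDegree * ⌈z⌉₊ := Nat.add_le_add_left hS' _

/-- **The classical upper bound for the prime values of one polynomial, every degree.** For
`g ∈ ℤ[X]` of degree `d ≥ 2` forming a Bateman–Horn system and every `δ > 0`:
`π_g(N) ≤ (2 C(g) + δ) N / log N` for all large `N` — `2d` times the Bateman–Horn prediction
`C(g) N /(d log N)` (Halberstam–Richert, *Sieve Methods*, Thm 5.3). -/
theorem eventually_polyPrimeCount_le {g : ℤ[X]} (hg : IsBatemanHornSystem ![g])
    (hdeg : 2 ≤ g.natDegree) {δ : ℝ} (hδ : 0 < δ) :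
    ∀ᶠ N : ℕ in atTop,
      (polyPrimeCount ![g] N : ℝ) ≤ (2 * batemanHornConst ![g] + δ) * N / Real.log N := by
  have hdeg0 : 0 < g.natDegree := by omega
  obtain ⟨c, hc0, hc1, hR⟩ := exists_level_eventually_card_rough_le hg hdeg (half_pos hδ)
  set d : ℕ := g.natDegree with hd
  have hJ := eventually_mul_rpow_mul_log_sq_le hc1 (A := 4 * (d : ℝ) + 1) (by positivity) (half_pos hδ)
  have hlog1 : ∀ᶠ N : ℕ in atTop, 1 ≤ Real.log N := by
    have h := (Real.tendsto_log_atTop.comp tendsto_natCast_atTop_atTop).eventually_ge_atTop (1 : ℝ)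
    filter_upwards [h] with N hN
    exact hN
  have hz1 : ∀ᶠ N : ℕ in atTop, (1 : ℝ) ≤ (N : ℝ) ^ c :=
    ((tendsto_rpow_atTop hc0).comp tendsto_natCast_atTop_atTop).eventually_ge_atTop 1
  filter_upwards [hR, hJ, hlog1, hz1, eventually_ge_atTop 2] with N hRN hJN hL1 hz hN2
  have hN : (2 : ℝ) ≤ N := by exact_mod_cast hN2
  have hlog0 : 0 < Real.log N := by linarith
  -- `π_g(N) ≤ #R + (2d ⌈N^c⌉ + 1)` and `2d ⌈N^c⌉ + 1 ≤ (4d + 1) N^c`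
  have h1 := (polyPrimeCount_le_card_add_one g N).trans
    (Nat.add_le_add_right (card_primeValues_le_card_rough_add g hdeg0 N ((N : ℝ) ^ c)) 1)
  have h1' : (polyPrimeCount ![g] N : ℝ) ≤
      #((Icc 1 N).filter fun n : ℕ => ((g.eval (n : ℤ)).natAbs).Coprime (primesProdBelow ((N : ℝ) ^ c)))
        + (2 * (d : ℝ) * (⌈(N : ℝ) ^ c⌉₊ : ℕ) + 1) := by
    rw [← hd] at h1
    exact_mod_cast h1
  have hceil : ((⌈(N : ℝ) ^ c⌉₊ : ℕ) : ℝ) ≤ (N : ℝ) ^ c + 1 := (Nat.ceil_lt_add_one (by positivity)).le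
  have hjunk : 2 * (d : ℝ) * (⌈(N : ℝ) ^ c⌉₊ : ℕ) + 1 ≤ (4 * (d : ℝ) + 1) * (N : ℝ) ^ c := by
    have hd0 : (0 : ℝ) ≤ d := Nat.cast_nonneg _
    nlinarith
  have hjunk' : (2 * (d : ℝ) * (⌈(N : ℝ) ^ c⌉₊ : ℕ) + 1) * Real.log N ≤ δ / 2 * N := by
    calc (2 * (d : ℝ) * (⌈(N : ℝ) ^ c⌉₊ : ℕ) + 1) * Real.log N
        ≤ (4 * (d : ℝ) + 1) * (N : ℝ) ^ c * Real.log N := by gcongr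
      _ ≤ (4 * (d : ℝ) + 1) * ((N : ℝ) ^ c * Real.log N ^ 2) := by
          rw [mul_assoc]
          gcongr
          nlinarith
      _ ≤ δ / 2 * N := hJN
  rw [le_div_iff₀ hlog0]
  have hRN' : (#((Icc 1 N).filter fun n : ℕ =>
      ((g.eval (n : ℤ)).natAbs).Coprime (primesProdBelow ((N : ℝ) ^ c))) : ℝ) * Real.log N ≤
        (2 * batemanHornConst ![g] + δ / 2) * N := (le_div_iff₀ hlog0).mp hRN
  calc (polyPrimeCount ![g] N : ℝ) * Real.log N
      ≤ (#((Icc 1 N).filter fun n : ℕ =>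
            ((g.eval (n : ℤ)).natAbs).Coprime (primesProdBelow ((N : ℝ) ^ c))) : ℝ) * Real.log N
          + (2 * (d : ℝ) * (⌈(N : ℝ) ^ c⌉₊ : ℕ) + 1) * Real.log N := by
        rw [← add_mul]
        exact mul_le_mul_of_nonneg_right h1' hlog0.le
    _ ≤ (2 * batemanHornConst ![g] + δ / 2) * N + δ / 2 * N := add_le_add hRN' hjunk'
    _ = (2 * batemanHornConst ![g] + δ) * N := by ring

end Summit.Parity.BatemanHorn.Theorems
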